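import Mathlib
import Literature.NumberTheory.Transcendental.OneMotiveToric
import Summits.Schanuel.Schanuel.Theses.RootDecomp1G

/-!
# RootDecomp1G — transversality-split glue (lens-6 gen 3, node «TransversalitySplit»)

Proves the glue item generated by the in-place split of route-Schanuel-RootDecomp1G (rev 1–3,
2026-08-30) `PeriodTransversality ⟸ JointTransversality ∧ DoublyFreePeriodTransversality`:

* `periodTransversalityGlue_holds : PeriodTransversalityGlue` (stmt-Schanuel-27370;
  = `JointTransversality → DoublyFreePeriodTransversality → PeriodTransversality`).

Mechanism: a kernel-free axis tuple `z` either is doubly free (then PT₀ verbatim) or contains the unit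
class (`1 ∈ span_ℚ z`); in the latter case exchange one coordinate for `1` (Steinitz), compare the
Schanuel fields of `z` and `(1, z″)` by the TRANSFER ENGINE (`w ⊆ span_ℚ z ⟹ trdeg ℚ(w, e^w) ≤
trdeg ℚ(z, e^z)`: the `e^{w_j}` are INTEGRAL over `ℚ(z, e^z)`), drop the unit, apply PT₀ then J at the
doubly-free remainder `z″`, transfer back. Trimmed from the node file
`HOME/decomp-schanuel-lens-6/g3/TransversalitySplit.lean` (lens-6 port `g3/prover/…port.lean` c667e7ac…; the census seat
inlined the shorthand `πi`, replaced the `expIntegral` submodule by the lemma `isIntegral_exp_of_mem_span` and `trdeg_mono`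
by Mathlib's `trdeg_le_of_injective`, so the file defines nothing); 0 sorry; no orphans.
-/

set_option linter.dupNamespace false

noncomputable section

open Complex IntermediateField

namespace Summit.Schanuel.Schanuel.Theorems.RootDecomp1GTransversalitySplit

open Summit.Schanuel.Schanuel.Theses.RootDecomp1G

/-! ### Tools -/

/-- The period generator `πi` of `ker exp = 2πiℤ` (up to the factor 2) is purely imaginary. -/
theorem pi_mul_I_re : ((Real.pi : ℂ) * Complex.I).re = 0 := by simp

/-- Cancelling a `+ 1` against a successor on the left of a cardinal inequality. -/
theorem natCast_le_of_succ_le_add_one {n : ℕ} {t : Cardinal} (h : ((n + 1 : ℕ) : Cardinal) ≤ t + 1) :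
    (n : Cardinal) ≤ t := by
  rcases lt_or_ge t Cardinal.aleph0 with hlt | hge
  · obtain ⟨m, rfl⟩ := Cardinal.lt_aleph0.mp hlt
    norm_cast at h ⊢
    omega
  · exact (Cardinal.natCast_lt_aleph0 (n := n)).le.trans hge

/-! ### Steinitz exchange for `Fin.cons` (gen 2, verbatim) -/

/-- Steinitz exchange: a nonzero `v ∈ span_ℚ z` can replace one coordinate `z j₀` keeping
`ℚ`-linear independence. -/
theorem exists_linearIndependent_cons_of_mem_span {n : ℕ} (z : Fin (n + 1) → ℂ)
    (hz : LinearIndependent ℚ z) {v : ℂ} (hv : v ∈ Submodule.span ℚ (Set.range z)) (hv0 : v ≠ 0) :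
    ∃ j₀ : Fin (n + 1), LinearIndependent ℚ (Fin.cons v (z ∘ Fin.succAbove j₀) : Fin (n + 1) → ℂ) := by
  classical
  obtain ⟨c, hc⟩ := (Submodule.mem_span_range_iff_exists_fun ℚ).mp hv
  have hc0 : ∃ j₀, c j₀ ≠ 0 := by
    by_contra h
    push Not at h
    apply hv0
    rw [← hc]
    exact Finset.sum_eq_zero fun j _ => by rw [h j, zero_smul]
  obtain ⟨j₀, hj₀⟩ := hc0
  refine ⟨j₀, ?_⟩
  rw [linearIndependent_finCons]
  refine ⟨hz.comp _ Fin.succAbove_right_injective, ?_⟩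
  intro hmem
  obtain ⟨d, hd⟩ := (Submodule.mem_span_range_iff_exists_fun ℚ).mp hmem
  let g : Fin (n + 1) → ℚ := Fin.insertNth j₀ (c j₀) (fun i => c (j₀.succAbove i) - d i)
  have hg0 : g j₀ = c j₀ := by simp [g]
  have hgs : ∀ i, g (j₀.succAbove i) = c (j₀.succAbove i) - d i := by intro i; simp [g]
  have h1 : c j₀ • z j₀ + ∑ i, c (j₀.succAbove i) • z (j₀.succAbove i) = v := by
    rw [← hc, Fin.sum_univ_succAbove _ j₀]
  have h2 : ∑ i, d i • z (j₀.succAbove i) = v := by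
    rw [← hd]
    rfl
  have hsum : ∑ j, g j • z j = 0 := by
    rw [Fin.sum_univ_succAbove _ j₀, hg0]
    simp only [hgs, sub_smul, Finset.sum_sub_distrib]
    rw [← add_sub_assoc, h1, h2, sub_self]
  have hzero := Fintype.linearIndependent_iff.mp hz g hsum j₀
  rw [hg0] at hzero
  exact hj₀ hzero

/-! ### Axis tuples: real and imaginary parts stay in the span -/

/-- For an AXIS tuple `z` (every coordinate real or purely imaginary) the ℚ-span of `z` is stable under
taking real parts. -/
theorem ofReal_re_mem_span {n : ℕ} {z : Fin n → ℂ} (haxis : ∀ j, (z j).im = 0 ∨ (z j).re = 0)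
    {x : ℂ} (hx : x ∈ Submodule.span ℚ (Set.range z)) :
    ((x.re : ℝ) : ℂ) ∈ Submodule.span ℚ (Set.range z) := by
  induction hx using Submodule.span_induction with
  | mem x hx =>
    obtain ⟨j, rfl⟩ := hx
    rcases haxis j with h | h
    · have hzj : (((z j).re : ℝ) : ℂ) = z j := Complex.ext (by simp) (by simp [h])
      rw [hzj]
      exact Submodule.subset_span ⟨j, rfl⟩
    · rw [h, Complex.ofReal_zero]
      exact zero_mem _
  | zero => simp
  | add x y _ _ hx hy =>
    rw [Complex.add_re, Complex.ofReal_add]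
    exact add_mem hx hy
  | smul q x _ hx =>
    have h1 : (((q • x).re : ℝ) : ℂ) = q • ((x.re : ℝ) : ℂ) := by
      rw [Rat.smul_def, Rat.smul_def]
      apply Complex.ext <;> simp
    rw [h1]
    exact Submodule.smul_mem _ q hx

/-- Axis `z`, `p` real, `q` purely imaginary: if `p ∈ span_ℚ(q, z)` then `p ∈ span_ℚ(z)`. -/
theorem mem_span_of_real_of_mem_span_insert {n : ℕ} {z : Fin n → ℂ}
    (haxis : ∀ j, (z j).im = 0 ∨ (z j).re = 0) {p q : ℂ} (hp : p.im = 0) (hq : q.re = 0)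
    (h : p ∈ Submodule.span ℚ (insert q (Set.range z))) : p ∈ Submodule.span ℚ (Set.range z) := by
  rw [Submodule.mem_span_insert] at h
  obtain ⟨a, v, hv, hpv⟩ := h
  have hre : p.re = v.re := by
    have := congrArg Complex.re hpv
    rw [Complex.add_re, Rat.smul_def, Complex.mul_re, Complex.ratCast_re, Complex.ratCast_im, hq] at this
    simpa using this
  have hp' : ((v.re : ℝ) : ℂ) = p := Complex.ext (by simp [hre]) (by simp [hp])
  rw [← hp']
  exact ofReal_re_mem_span haxis hv

/-! ### The transfer engine: `trdeg ℚ(w, e^w) ≤ trdeg ℚ(z, e^z)` whenever `w ⊆ span_ℚ(z)` -/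

/-- If `x` lies in the `ℚ`-span of a tuple `z`, then `e^x` is INTEGRAL over `ℚ(z, e^z)`
(`e^{v+w} = e^v e^w`, and `(e^{qv})^{den q} = (e^v)^{num q}`): the transfer engine's key input. -/
theorem isIntegral_exp_of_mem_span {n : ℕ} (z : Fin n → ℂ) {x : ℂ}
    (hx : x ∈ Submodule.span ℚ (Set.range z)) :
    IsIntegral (IntermediateField.adjoin ℚ (Set.range z ∪ Set.range (cexp ∘ z))) (cexp x) := by
  set K := IntermediateField.adjoin ℚ (Set.range z ∪ Set.range (cexp ∘ z))
  induction hx using Submodule.span_induction with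
  | mem v hv =>
    obtain ⟨j, rfl⟩ := hv
    have hmem : cexp (z j) ∈ K := IntermediateField.subset_adjoin ℚ _ (Or.inr ⟨j, rfl⟩)
    exact isIntegral_algebraMap (R := K) (A := ℂ) (x := ⟨cexp (z j), hmem⟩)
  | zero => rw [Complex.exp_zero]; exact isIntegral_one
  | add a b _ _ ha hb => rw [Complex.exp_add]; exact ha.mul hb
  | smul q v _ hv =>
    refine IsIntegral.of_pow q.den_pos ?_
    have key : cexp (q • v) ^ q.den = cexp v ^ q.num := by
      rw [← Complex.exp_nat_mul, ← Complex.exp_int_mul, Rat.smul_def, ← mul_assoc]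
      congr 2
      have h := congrArg (fun r : ℚ => (r : ℂ)) (Rat.mul_den_eq_num q)
      push_cast at h
      rw [mul_comm]
      exact h
    rw [key]
    obtain ⟨m, hm | hm⟩ := Int.eq_nat_or_neg q.num
    · rw [hm, zpow_natCast]
      exact hv.pow m
    · rw [hm, zpow_neg, zpow_natCast, ← inv_pow]
      exact hv.inv.pow m

/-- The span of a tuple `z` lies in the field `ℚ(z, e^z)`. -/
theorem span_le_adjoin {n : ℕ} (z : Fin n → ℂ) {x : ℂ} (hx : x ∈ Submodule.span ℚ (Set.range z)) :
    x ∈ IntermediateField.adjoin ℚ (Set.range z ∪ Set.range (cexp ∘ z)) := by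
  set K := IntermediateField.adjoin ℚ (Set.range z ∪ Set.range (cexp ∘ z))
  induction hx using Submodule.span_induction with
  | mem x hx =>
    obtain ⟨j, rfl⟩ := hx
    exact IntermediateField.subset_adjoin ℚ _ (Or.inl ⟨j, rfl⟩)
  | zero => exact zero_mem K
  | add x y _ _ hx hy => exact add_mem hx hy
  | smul q x _ hx => exact IntermediateField.smul_mem K hx

set_option synthInstance.maxHeartbeats 400000 in
/-- `trdeg` along the tower `K ⊆ K(S) ⊆ K(S)(T) = K(S ∪ T)` (gen 2, verbatim). -/
theorem trdeg_adjoin_adjoin_eq {K E : Type*} [Field K] [Field E] [Algebra K E] (S T : Set E) :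
    Algebra.trdeg K (adjoin K S) + Algebra.trdeg (adjoin K S) (adjoin (adjoin K S) T) =
      Algebra.trdeg K (adjoin K (S ∪ T)) := by
  haveI : FaithfulSMul (adjoin K S) (adjoin (adjoin K S) T) :=
    ⟨fun {m₁ m₂} h => (algebraMap (adjoin K S) (adjoin (adjoin K S) T)).injective
      (by simpa [Algebra.smul_def] using h 1)⟩
  have htower := trdeg_add_eq K (adjoin K S) (A := adjoin (adjoin K S) T)
  have heq : Algebra.trdeg K (adjoin (adjoin K S) T) = Algebra.trdeg K (adjoin K (S ∪ T)) := by
    rw [← (equivOfEq (adjoin_adjoin_left K S T)).trdeg_eq]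
    rfl
  rw [htower, heq]

set_option synthInstance.maxHeartbeats 400000 in
/-- Adjoining elements INTEGRAL over `ℚ(G)` does not change `trdeg_ℚ`. -/
theorem trdeg_adjoin_union_eq_of_isIntegral (G T : Set ℂ)
    (hT : ∀ x ∈ T, IsIntegral (adjoin ℚ G) x) :
    Algebra.trdeg ℚ ↥(adjoin ℚ (G ∪ T)) = Algebra.trdeg ℚ ↥(adjoin ℚ G) := by
  haveI : Algebra.IsAlgebraic (adjoin ℚ G) (adjoin (adjoin ℚ G) T) :=
    IntermediateField.isAlgebraic_adjoin hT
  have h := trdeg_adjoin_adjoin_eq (K := ℚ) G T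
  have h0 : Algebra.trdeg ↥(adjoin ℚ G) ↥(adjoin (↥(adjoin ℚ G)) T) = 0 := trdeg_eq_zero
  rw [h0, add_zero] at h
  exact h.symm

/-- THE TRANSFER ENGINE. If every coordinate of `w` is a ℚ-combination of the coordinates of `z`, then
`trdeg ℚ(w, e^w) ≤ trdeg ℚ(z, e^z)`: the `w j` lie in `ℚ(z)` and the `e^{w j}` are radicals of monomials
in the `e^{z i}`, hence integral over `ℚ(z, e^z)`. -/
theorem trdeg_le_of_subset_span {n m : ℕ} (z : Fin n → ℂ) (w : Fin m → ℂ)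
    (hw : ∀ j, w j ∈ Submodule.span ℚ (Set.range z)) :
    Algebra.trdeg ℚ ↥(adjoin ℚ (Set.range w ∪ Set.range (cexp ∘ w))) ≤
      Algebra.trdeg ℚ ↥(adjoin ℚ (Set.range z ∪ Set.range (cexp ∘ z))) := by
  set G := Set.range z ∪ Set.range (cexp ∘ z) with hG
  set T := Set.range w ∪ Set.range (cexp ∘ w) with hT
  have hint : ∀ x ∈ T, IsIntegral (adjoin ℚ G) x := by
    rintro x (⟨j, rfl⟩ | ⟨j, rfl⟩)
    · have hmem : w j ∈ adjoin ℚ G := span_le_adjoin z (hw j)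
      exact isIntegral_algebraMap (R := adjoin ℚ G) (A := ℂ) (x := ⟨w j, hmem⟩)
    · exact isIntegral_exp_of_mem_span z (hw j)
  calc Algebra.trdeg ℚ ↥(adjoin ℚ T)
      ≤ Algebra.trdeg ℚ ↥(adjoin ℚ (G ∪ T)) := trdeg_le_of_injective (IntermediateField.inclusion (adjoin.mono ℚ _ _ Set.subset_union_right))
        (IntermediateField.inclusion_injective _)
    _ = Algebra.trdeg ℚ ↥(adjoin ℚ G) := trdeg_adjoin_union_eq_of_isIntegral G T hint

/-- Two tuples with comparable spans of the same finite rank have the same span; used as: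
`w ⊆ span z`, both ℚ-free of the same length ⟹ `z ⊆ span w`. -/
theorem mem_span_of_span_le_of_linearIndependent {n : ℕ} {z w : Fin n → ℂ}
    (hz : LinearIndependent ℚ z) (hw : LinearIndependent ℚ w)
    (hle : ∀ j, w j ∈ Submodule.span ℚ (Set.range z)) :
    ∀ i, z i ∈ Submodule.span ℚ (Set.range w) := by
  have hle' : Submodule.span ℚ (Set.range w) ≤ Submodule.span ℚ (Set.range z) :=
    Submodule.span_le.mpr (by rintro _ ⟨j, rfl⟩; exact hle j)
  haveI := FiniteDimensional.span_of_finite ℚ (Set.finite_range z)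
  have heq : Submodule.span ℚ (Set.range w) = Submodule.span ℚ (Set.range z) := by
    apply Submodule.eq_of_le_of_finrank_eq hle'
    rw [finrank_span_eq_card hw, finrank_span_eq_card hz]
  intro i
  rw [heq]
  exact Submodule.subset_span ⟨i, rfl⟩


/-! ### Adjoining one cheap coordinate costs at most one -/

/-- If `a` and `e^a` both lie in `ℚ(b, z, e^z)` then `ℚ(a, z, e^a, e^z) ⊆ ℚ(b, z, e^z)`. -/
theorem adjoin_cons_le_adjoin_insert {n : ℕ} (a b : ℂ) (z : Fin n → ℂ)
    (ha : a ∈ adjoin ℚ (insert b (Set.range z ∪ Set.range (cexp ∘ z))))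
    (hea : cexp a ∈ adjoin ℚ (insert b (Set.range z ∪ Set.range (cexp ∘ z)))) :
    adjoin ℚ (Set.range (Fin.cons a z : Fin (n + 1) → ℂ) ∪
        Set.range (cexp ∘ (Fin.cons a z : Fin (n + 1) → ℂ))) ≤
      adjoin ℚ (insert b (Set.range z ∪ Set.range (cexp ∘ z))) := by
  have hsub := IntermediateField.subset_adjoin ℚ (insert b (Set.range z ∪ Set.range (cexp ∘ z)))
  rw [IntermediateField.adjoin_le_iff]
  rintro x (⟨j, rfl⟩ | ⟨j, rfl⟩)
  · refine Fin.cases ?_ (fun i => ?_) j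
    · simpa only [Fin.cons_zero, SetLike.mem_coe] using ha
    · simpa only [Fin.cons_succ, SetLike.mem_coe] using hsub (Set.mem_insert_of_mem _ (Or.inl ⟨i, rfl⟩))
  · refine Fin.cases ?_ (fun i => ?_) j
    · simpa only [Function.comp_apply, Fin.cons_zero, SetLike.mem_coe] using hea
    · simpa only [Function.comp_apply, Fin.cons_succ, SetLike.mem_coe] using
        hsub (Set.mem_insert_of_mem _ (Or.inr ⟨i, rfl⟩))

/-- Adjoining the UNIT costs at most one: `trdeg ℚ(1, z, e, e^z) ≤ trdeg ℚ(z, e^z) + 1` (`1 ∈ ℚ`). -/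
theorem trdeg_cons_one_le_add_one {n : ℕ} (z : Fin n → ℂ) :
    Algebra.trdeg ℚ ↥(adjoin ℚ (Set.range (Fin.cons (1 : ℂ) z : Fin (n + 1) → ℂ) ∪
        Set.range (cexp ∘ (Fin.cons (1 : ℂ) z : Fin (n + 1) → ℂ)))) ≤
      Algebra.trdeg ℚ ↥(adjoin ℚ (Set.range z ∪ Set.range (cexp ∘ z))) + 1 := by
  have hle := adjoin_cons_le_adjoin_insert 1 (cexp 1) z (one_mem _)
    (IntermediateField.subset_adjoin ℚ _ (Set.mem_insert _ _))
  exact (trdeg_le_of_injective (IntermediateField.inclusion hle)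
      (IntermediateField.inclusion_injective hle)).trans
    (Literature.NumberTheory.Transcendental.trdeg_adjoin_insert_le _ _)

/-! ## The glue: `PT₀ ∧ J ⟹ PT` -/

/-- GLUE of the round-2 split (the generated item `PeriodTransversalityGlue`): doubly-free period
transversality and joint transversality imply period transversality. Doubly-free `z`: PT₀ verbatim.
Unit-class `z` (`1 ∈ span z`): exchange a coordinate for `1` (`z ~ (1, z″)`, `z″` doubly free; the
Schanuel fields of `z` and `(1, z″)` have the same `trdeg` by the transfer engine), drop the unit
(`S(z″)` at cost ≤ 1), apply PT₀ at `z″` (`S(πi, z″)`), then J at `z″` (`S(1, πi, z″)`), transfer back. -/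
theorem periodTransversality_of_split (h0 : DoublyFreePeriodTransversality) (hJ : JointTransversality) :
    PeriodTransversality := by
  classical
  intro n z haxis hker hS
  by_cases h1 : (1 : ℂ) ∈ Submodule.span ℚ (Set.range z)
  · -- unit class
    cases n with
    | zero =>
      exfalso
      simp [Set.range_eq_empty] at h1
    | succ n' =>
      have hz : LinearIndependent ℚ z := (linearIndependent_finCons.mp hker).1
      have hpi : ((Real.pi : ℂ) * Complex.I) ∉ Submodule.span ℚ (Set.range z) := (linearIndependent_finCons.mp hker).2
      obtain ⟨j₀, hcons⟩ := exists_linearIndependent_cons_of_mem_span z hz h1 one_ne_zero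
      set z'' : Fin n' → ℂ := z ∘ Fin.succAbove j₀ with hz''def
      have haxis'' : ∀ j, (z'' j).im = 0 ∨ (z'' j).re = 0 := fun j => haxis _
      have hz'' : LinearIndependent ℚ z'' := (linearIndependent_finCons.mp hcons).1
      have h1'' : (1 : ℂ) ∉ Submodule.span ℚ (Set.range z'') := (linearIndependent_finCons.mp hcons).2
      have hspan'' : Submodule.span ℚ (Set.range z'') ≤ Submodule.span ℚ (Set.range z) :=
        Submodule.span_mono (Set.range_comp_subset_range _ _)
      -- the unit tuple `u = (1, z″)` spans the same ℚ-space as `z`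
      have hu_sub : ∀ j, (Fin.cons (1 : ℂ) z'' : Fin (n' + 1) → ℂ) j ∈ Submodule.span ℚ (Set.range z) :=
        fun j => Fin.cases (by simpa using h1) (fun i => by
          simp only [Fin.cons_succ]
          exact Submodule.subset_span (Set.mem_range_self (j₀.succAbove i))) j
      have hz_sub : ∀ i, z i ∈ Submodule.span ℚ (Set.range (Fin.cons (1 : ℂ) z'' : Fin (n' + 1) → ℂ)) :=
        mem_span_of_span_le_of_linearIndependent hz hcons hu_sub
      -- (a) `S(1, z″)` from `S(z)`; (b) `S(z″)` by dropping the unit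
      have hS1 : ((n' + 1 : ℕ) : Cardinal) ≤ Algebra.trdeg ℚ ↥(adjoin ℚ (Set.range (Fin.cons (1 : ℂ) z'' : Fin (n' + 1) → ℂ) ∪ Set.range (cexp ∘ (Fin.cons (1 : ℂ) z'' : Fin (n' + 1) → ℂ)))) := hS.trans (trdeg_le_of_subset_span _ z hz_sub)
      have hS0 : (n' : Cardinal) ≤ Algebra.trdeg ℚ ↥(adjoin ℚ (Set.range z'' ∪ Set.range (cexp ∘ z''))) := natCast_le_of_succ_le_add_one (hS1.trans (trdeg_cons_one_le_add_one z''))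
      -- (c) `z″` is doubly free
      have hdf : LinearIndependent ℚ (Fin.cons (1 : ℂ) (Fin.cons ((Real.pi : ℂ) * Complex.I) z'') : Fin (n' + 2) → ℂ) := by
        rw [linearIndependent_finCons]
        refine ⟨linearIndependent_finCons.mpr ⟨hz'', fun hmem => hpi (hspan'' hmem)⟩, fun hmem => h1'' ?_⟩
        rw [Fin.range_cons] at hmem
        exact mem_span_of_real_of_mem_span_insert haxis'' (by simp) pi_mul_I_re hmem
      -- (d) PT₀ at `z″`, (e) J at `z″`
      have hSpi : ((n' + 1 : ℕ) : Cardinal) ≤ Algebra.trdeg ℚ ↥(adjoin ℚ (Set.range (Fin.cons ((Real.pi : ℂ) * Complex.I) z'' : Fin (n' + 1) → ℂ) ∪ Set.range (cexp ∘ (Fin.cons ((Real.pi : ℂ) * Complex.I) z'' : Fin (n' + 1) → ℂ)))) := h0 n' z'' haxis'' hdf hS0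
      have hSJ : ((n' + 2 : ℕ) : Cardinal) ≤ Algebra.trdeg ℚ ↥(adjoin ℚ (Set.range (Fin.cons (1 : ℂ) (Fin.cons ((Real.pi : ℂ) * Complex.I) z'') : Fin (n' + 2) → ℂ) ∪ Set.range (cexp ∘ (Fin.cons (1 : ℂ) (Fin.cons ((Real.pi : ℂ) * Complex.I) z'') : Fin (n' + 2) → ℂ)))) := hJ n' z'' haxis'' hdf hS1 hSpi
      -- (f) transfer to `(πi, z)`
      have hsub : ∀ j, (Fin.cons (1 : ℂ) (Fin.cons ((Real.pi : ℂ) * Complex.I) z'') : Fin (n' + 2) → ℂ) j ∈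
          Submodule.span ℚ (Set.range (Fin.cons ((Real.pi : ℂ) * Complex.I) z : Fin (n' + 2) → ℂ)) := by
        have hzsub : Submodule.span ℚ (Set.range z) ≤
            Submodule.span ℚ (Set.range (Fin.cons ((Real.pi : ℂ) * Complex.I) z : Fin (n' + 2) → ℂ)) :=
          Submodule.span_mono (by rw [Fin.range_cons]; exact Set.subset_insert _ _)
        intro j
        refine Fin.cases ?_ (fun k => Fin.cases ?_ (fun l => ?_) k) j
        · simp only [Fin.cons_zero]
          exact hzsub h1
        · simp only [Fin.cons_succ, Fin.cons_zero]
          have hpi_mem : ((Real.pi : ℂ) * Complex.I) ∈ Set.range (Fin.cons ((Real.pi : ℂ) * Complex.I) z : Fin (n' + 2) → ℂ) := ⟨0, rfl⟩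
          exact Submodule.subset_span hpi_mem
        · simp only [Fin.cons_succ]
          exact hzsub (Submodule.subset_span (Set.mem_range_self (j₀.succAbove l)))
      exact hSJ.trans (trdeg_le_of_subset_span _ _ hsub)
  · -- doubly free
    have hdf : LinearIndependent ℚ (Fin.cons (1 : ℂ) (Fin.cons ((Real.pi : ℂ) * Complex.I) z) : Fin (n + 2) → ℂ) := by
      rw [linearIndependent_finCons]
      refine ⟨hker, fun hmem => h1 ?_⟩
      rw [Fin.range_cons] at hmem
      exact mem_span_of_real_of_mem_span_insert haxis (by simp) pi_mul_I_re hmem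
    exact h0 n z haxis hdf hS


/-- THE GLUE ITEM of the round-2 split of route-Schanuel-RootDecomp1G (stmt-Schanuel-27370; gate body
`JointTransversality → DoublyFreePeriodTransversality → PeriodTransversality`, rev 1 commit 0a55740d). -/
theorem periodTransversalityGlue_holds : PeriodTransversalityGlue := fun hJ h0 =>
  periodTransversality_of_split h0 hJ

end Summit.Schanuel.Schanuel.Theorems.RootDecomp1GTransversalitySplit
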